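import Summits.BirchSwinnertonDyer.BirchSwinnertonDyer.Theorems.GoldfeldAllTwistsTwoConverseTwinAdditiveInertTwistDescent
import Literature.NumberTheory.EllipticCurves.TwoIsogenyShaTwoTorsion
import Literature.NumberTheory.EllipticCurves.TwoIsogenyCasselsParity
import Literature.NumberTheory.EllipticCurves.ZpCorankQuasiIso
import Literature.NumberTheory.EllipticCurves.SelmerCorankProofs
import Literature.NumberTheory.EllipticCurves.SelmerCorankIsogenyProofs
import Literature.NumberTheory.EllipticCurves.SelmerCorankHolds
import Literature.NumberTheory.EllipticCurves.ShaProofs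
import Literature.NumberTheory.EllipticCurves.SelmerProofs
import Literature.NumberTheory.EllipticCurves.SelmerFiniteProofs
import HarnessLib

set_option linter.dupNamespace false -- namespace `…BirchSwinnertonDyer.BirchSwinnertonDyer…` is the cell's (D-0017 nested layout)
set_option autoImplicit false

/-!
# Route `GoldfeldAllTwistsTwoConverse`, cruxes K12₂″ (item 20044) / twin″ (item 19140): a complete `2`-isogeny
# descent with `#S · #S' ≤ 8` bounds the `2^∞`-Selmer CORANK by `1` (part 1: the counting)

Cell `bsd-goldfeld`, seat `bsd-goldfeld-s1p-c301` (prover, gen 3); items `stmt-BirchSwinnertonDyer-20044` (K12₂″) and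
`stmt-BirchSwinnertonDyer-19140` (twin″), both OPEN; nothing asserted about them here. Theorems only: no definition,
no axiom, no `sorry`, no fact binder.

Seat c301 gen 2's complete `2`-isogeny descents (`#S · #S' ≤ 8`, cell memo PRIME-TWIST-DESCENT.md) gave `rank ≤ 1`
and `rank = 1 ⇒ Ш[2] = 0`. This file extracts the stronger corank statement, needed to make the HYPOTHESIS of K12₂″
(`corank_{ℤ₂} Sel_{2^∞} = 1`) automatic on the descent families (part 2, `GoldfeldK12AdditiveTwoDescentFamiliesCorank`):

* §1 `natCard_sha_inf_torsionBy_two_le` (any number field, `V` in two-torsion normal form, `V' = V/⟨T⟩`):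
  **`#Ш(V')[2] ≤ #Ш(V)[φ] · #Ш(V')[φ̂]`** — the inequality form of the tree's
  `eq_zero_of_mem_sha_twoIsogenyCodomain_of_two_smul_eq_zero` (`φ ∘ φ̂ = [2]`: `φ̂_*` maps `Ш(V')[2]` into
  `Ш(V) ∩ ker φ_* = Ш(V) ∩ im Ξ_V` with kernel in `Ш(V') ∩ ker φ̂_* = Ш(V') ∩ im Ξ_{V'}`; first isomorphism theorem).
* §2 `shaCorank_two_le_one_of_natCard_le`: `#Ш[2] ≤ 2 ⇒ corank_{ℤ₂} Ш[2^∞] ≤ 1` (`Ш[2^∞][2] ↪ Ш[2]` has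
  `𝔽₂`-dimension `≤ 1`, and the tree's corank `dim Ш[2^∞][2] − dim Ш[2^∞]/2` is at most that).
* §3 `selmerCorank_two_le_one_of_card_mul_le`: for `E_{a,b} : y² = x³ + ax² + bx` over `ℚ` with
  `#S(a,b)·#S'(a,b) ≤ 8`, **`corank_{ℤ₂} Sel_{2^∞}(E/ℚ) ≤ 1`**: by the exact count
  `2^{dim S + dim S'} = 2^{rank+2}·#Ш(E')[φ̂]·#Ш(E)[φ]` (Silverman X.4.2(a), tree `two_pow_twoIsogenySelmerRank_add_eq`)
  either `rank = 1` and both `φ`-parts vanish (`Ш[2] = 0`, corank `1 + 0`), or `rank = 0` and `#Ш(E')[φ̂]·#Ш(E)[φ] ≤ 2`,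
  so `#Ш(E)[2] ≤ 2` (§1) and corank `0 + (≤ 1)` (§2 and Greenberg's identity `corank Sel = rank + corank Ш`,
  tree theorem `selmerCorank_eq_mordellWeilRank_add_holds`).

References: J. H. Silverman, *AEC* (2009) Thm. X.4.2(a), Prop. X.4.9, Thm. III.6.1–6.2 [SilvermanAEC2009];
R. Greenberg, LNM 1716 (1999) §1 [Greenberg1999].
-/

noncomputable section

open scoped Classical

open WeierstrassCurve Literature.NumberTheory.EllipticCurves Literature.NumberTheory.EllipticCurves.ModularForms
  Literature.NumberTheory.EllipticCurves.Rank1Residual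

namespace Summit.BirchSwinnertonDyer.BirchSwinnertonDyer.Theorems.GoldfeldGoodTwists

open _root_.WeierstrassCurve.Affine (SqUnits)

universe u

/-! ## §1 `#Ш(V')[2] ≤ #Ш(V)[φ] · #Ш(V')[φ̂]` for the explicit `2`-isogeny `φ : V → V'` -/

section Counting

variable {K : Type u} [Field K] [NumberField K] (V : WeierstrassCurve K) [V.IsTwoTorsionNF] [V.IsElliptic]

/-- **`#Ш(V')[2] ≤ #Ш(V)[φ] · #Ш(V')[φ̂]`** for `V` in two-torsion normal form over a number field, `V' = V.twoIsogenyCodomain`,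
`Ш(V)[φ] = Ш(V) ∩ im Ξ_V` and `Ш(V')[φ̂] = Ш(V') ∩ im Ξ_{V'}` (the two `Ξ`-parts, assumed finite). With the dual
`φ̂ : V' → V` (`φ ∘ φ̂ = [2]`, `exists_isogeny_comp_twoIsogeny_eq_two`): `φ̂_*` maps `Ш(V')[2]` into
`Ш(V) ∩ ker φ_* = Ш(V)[φ]` (`galH1Map_mem_sha`, `range_twoIsogenyTorsorHom_eq_ker_galH1Map`), with kernel inside
`Ш(V') ∩ ker φ̂_* = Ш(V')[φ̂]` (`ker_galH1Map_eq_of_comp_twoIsogeny`); count with the first isomorphism theorem.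
The inequality form of the tree's `eq_zero_of_mem_sha_twoIsogenyCodomain_of_two_smul_eq_zero`.
[cite: SilvermanAEC2009, Thm. X.4.2(a) and Thm. III.6.2(a)] -/
theorem natCard_sha_inf_torsionBy_two_le
    [Finite ↥(V.sha ⊓ AddMonoidHom.range (G := Additive (SqUnits K)) V.twoIsogenyTorsorHom)]
    [Finite ↥(V.twoIsogenyCodomain.sha ⊓ AddMonoidHom.range (G := Additive (SqUnits K)) V.twoIsogenyCodomain.twoIsogenyTorsorHom)] :
    Nat.card ↥(V.twoIsogenyCodomain.sha ⊓ AddSubgroup.torsionBy V.twoIsogenyCodomain.galH1 2) ≤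
      Nat.card ↥(V.sha ⊓ AddMonoidHom.range (G := Additive (SqUnits K)) V.twoIsogenyTorsorHom) *
        Nat.card ↥(V.twoIsogenyCodomain.sha ⊓
          AddMonoidHom.range (G := Additive (SqUnits K)) V.twoIsogenyCodomain.twoIsogenyTorsorHom) := by
  obtain ⟨ψ, hψφ, hφψ⟩ := V.exists_isogeny_comp_twoIsogeny_eq_two
  set A : AddSubgroup V.twoIsogenyCodomain.galH1 :=
    V.twoIsogenyCodomain.sha ⊓ AddSubgroup.torsionBy V.twoIsogenyCodomain.galH1 2 with hA
  set T : AddSubgroup V.galH1 :=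
    V.sha ⊓ AddMonoidHom.range (G := Additive (SqUnits K)) V.twoIsogenyTorsorHom with hT
  set T' : AddSubgroup V.twoIsogenyCodomain.galH1 := V.twoIsogenyCodomain.sha ⊓
    AddMonoidHom.range (G := Additive (SqUnits K)) V.twoIsogenyCodomain.twoIsogenyTorsorHom with hT'
  set g : V.twoIsogenyCodomain.galH1 →+ V.galH1 := galH1Map ψ.toAddMonoidHom ψ.equivariant with hg
  -- the restriction of `φ̂_*` to `A = Ш(V')[2]`
  set gA : ↥A →+ V.galH1 := g.comp A.subtype with hgA
  -- its range lies in `T = Ш(V)[φ]`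
  have hrange : gA.range ≤ T := by
    rintro x ⟨c, rfl⟩
    have hc := AddSubgroup.mem_inf.mp c.2
    refine AddSubgroup.mem_inf.mpr ⟨?_, ?_⟩
    · exact galH1Map_mem_sha ψ.toAddMonoidHom ψ.equivariant ψ.hasLocalPointsMaps_toAddMonoidHom hc.1
    · rw [range_twoIsogenyTorsorHom_eq_ker_galH1Map, AddMonoidHom.mem_ker]
      change galH1Map V.twoIsogenyGeomHom (twoIsogenyGeomHom_smul V) (g c) = 0
      rw [hg, galH1Map_galH1Map_of_comp_eq_nsmul ψ.toAddMonoidHom ψ.equivariant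
        V.twoIsogenyGeomHom (twoIsogenyGeomHom_smul V) hφψ c]
      exact AddSubgroup.torsionBy.nsmul_iff.mp hc.2
  -- its kernel injects into `T' = Ш(V')[φ̂]`
  have hker : ∀ c : ↥A, gA c = 0 → (c : V.twoIsogenyCodomain.galH1) ∈ T' := by
    intro c hc0
    have hc := AddSubgroup.mem_inf.mp c.2
    refine AddSubgroup.mem_inf.mpr ⟨hc.1, ?_⟩
    rw [range_twoIsogenyTorsorHom_eq_ker_galH1Map,
      ← ker_galH1Map_eq_of_comp_twoIsogeny ψ.toAddMonoidHom ψ.equivariant (fun P ↦ ?_),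
      AddMonoidHom.mem_ker]
    · exact hc0
    · rw [hψφ, ← natCast_zsmul]
  let ι : ↥gA.ker → ↥T' := fun c ↦ ⟨(c.1 : V.twoIsogenyCodomain.galH1), hker c.1 c.2⟩
  have hι : Function.Injective ι := by
    intro c₁ c₂ h
    have h1 : ((c₁.1 : ↥A) : V.twoIsogenyCodomain.galH1) = (c₂.1 : ↥A) := by
      simpa [ι] using congrArg Subtype.val h
    exact Subtype.ext (Subtype.ext h1)
  calc Nat.card ↥A = Nat.card gA.ker * Nat.card gA.range := natCard_eq_card_ker_mul_card_range gA
    _ ≤ Nat.card ↥T' * Nat.card ↥T :=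
        Nat.mul_le_mul (Nat.card_le_card_of_injective ι hι) (AddSubgroup.card_le_of_le hrange)
    _ = Nat.card ↥T * Nat.card ↥T' := mul_comm _ _

end Counting

/-! ## §2 `#Ш[2] ≤ 2 ⇒ corank_{ℤ₂} Ш[2^∞] ≤ 1` -/

section ShaCorank

variable {K : Type u} [Field K] [NumberField K] (W : WeierstrassCurve K)

/-- **`#Ш(W)[2] ≤ 2 ⇒ corank_{ℤ₂} Ш(W)[2^∞] ≤ 1`**: the `2`-torsion of the `2`-primary part `Ш[2^∞]` injects into
`Ш[2]`, so `dim_{𝔽₂} Ш[2^∞][2] ≤ 1`, and the corank `dim Ш[2^∞][2] − dim Ш[2^∞]/2` is at most that dimension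
(Greenberg 1999 §1: `Ш[2^∞] ≅ (ℚ₂/ℤ₂)^c ⊕ finite` has `#Ш[2] ≥ 2^c`). [cite: Greenberg1999, §1] -/
theorem shaCorank_two_le_one_of_natCard_le [Finite ↥(W.sha ⊓ AddSubgroup.torsionBy W.galH1 2)]
    (h : Nat.card ↥(W.sha ⊓ AddSubgroup.torsionBy W.galH1 2) ≤ 2) : W.shaCorank 2 ≤ 1 := by
  haveI : Fact (Nat.Prime 2) := ⟨Nat.prime_two⟩
  set P := AddCommGroup.primaryComponent W.sha 2 with hP
  -- `P[2] ↪ Ш[2]`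
  let ι : ↥(AddSubgroup.torsionBy ↥P ((2 : ℕ) : ℤ)) → ↥(W.sha ⊓ AddSubgroup.torsionBy W.galH1 2) :=
    fun x ↦ ⟨((x.1 : ↥P) : ↥W.sha), by
      refine AddSubgroup.mem_inf.mpr ⟨((x.1 : ↥P) : ↥W.sha).2, AddSubgroup.torsionBy.nsmul_iff.mpr ?_⟩
      have hx : (2 : ℕ) • (x.1 : ↥P) = 0 := AddSubgroup.torsionBy.nsmul_iff.mp x.2
      have h' := congrArg (fun y : ↥P ↦ ((y : ↥W.sha) : W.galH1)) hx
      simpa using h'⟩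
  have hι : Function.Injective ι := by
    intro x y hxy
    have h1 : (((x.1 : ↥P) : ↥W.sha) : W.galH1) = (((y.1 : ↥P) : ↥W.sha) : W.galH1) :=
      congrArg (fun z : ↥(W.sha ⊓ AddSubgroup.torsionBy W.galH1 2) ↦ (z : W.galH1)) hxy
    exact Subtype.ext (Subtype.ext (Subtype.ext h1))
  haveI : Finite ↥(AddSubgroup.torsionBy ↥P ((2 : ℕ) : ℤ)) := Finite.of_injective ι hι
  have hcard : Nat.card ↥(AddSubgroup.torsionBy ↥P ((2 : ℕ) : ℤ)) ≤ 2 :=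
    (Nat.card_le_card_of_injective ι hι).trans h
  -- `dim_{𝔽₂} P[2] ≤ 1`
  letI : Module (ZMod 2) ↥(AddSubgroup.torsionBy ↥P ((2 : ℕ) : ℤ)) := AddSubgroup.torsionBy.zmodModule
  have hpow := pow_finrank_eq_natCard (p := 2) ↥(AddSubgroup.torsionBy ↥P ((2 : ℕ) : ℤ))
  have hfin : Module.finrank (ZMod 2) ↥(AddSubgroup.torsionBy ↥P ((2 : ℕ) : ℤ)) ≤ 1 := by
    by_contra hlt
    have h4 : 2 ^ 2 ≤ 2 ^ Module.finrank (ZMod 2) ↥(AddSubgroup.torsionBy ↥P ((2 : ℕ) : ℤ)) :=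
      Nat.pow_le_pow_right (by norm_num) (by omega)
    omega
  -- corank `≤` that dimension
  unfold WeierstrassCurve.shaCorank zpCorank
  exact (Nat.sub_le _ _).trans hfin

end ShaCorank

/-! ## §3 `corank_{ℤ₂} Sel_{2^∞}(E_{a,b}/ℚ) ≤ 1` from `#S(a,b) · #S'(a,b) ≤ 8` -/

section TwoTorsionModel

/-- Transport of `#Ш(X)[2]` along an equality of curves. [folklore] -/
theorem natCard_sha_inf_torsionBy_two_congr {K : Type u} [Field K] [NumberField K] {X Y : WeierstrassCurve K}
    (h : X = Y) :
    Nat.card ↥(X.sha ⊓ AddSubgroup.torsionBy X.galH1 2) = Nat.card ↥(Y.sha ⊓ AddSubgroup.torsionBy Y.galH1 2) := by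
  subst h
  rfl

/-- Arithmetic core: `2^{r+2}·(n₁ n₂) ≤ 8` with `n₁ n₂ ≠ 0` gives `r ≤ 1`, `n₁ n₂ ≤ 2`, and `n₁ = n₂ = 1` if
`r = 1`. [folklore] -/
private theorem corank_arith {r n₁ n₂ k : ℕ} (hk : k = 2 ^ (r + 2) * (n₁ * n₂)) (hk8 : k ≤ 8) (hkpos : 0 < k) :
    r ≤ 1 ∧ 0 < n₁ ∧ 0 < n₂ ∧ n₁ * n₂ ≤ 2 ∧ (r = 1 → n₁ = 1 ∧ n₂ = 1) := by
  subst hk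
  have hn₁ : 0 < n₁ := Nat.pos_of_ne_zero (by rintro rfl; simp at hkpos)
  have hn₂ : 0 < n₂ := Nat.pos_of_ne_zero (by rintro rfl; simp at hkpos)
  have h4 : 4 ≤ 2 ^ (r + 2) := by
    calc (4 : ℕ) = 2 ^ 2 := by norm_num
      _ ≤ 2 ^ (r + 2) := Nat.pow_le_pow_right (by norm_num) (by omega)
  have hprod : n₁ * n₂ ≤ 2 := by nlinarith
  have h2 : 2 ^ (r + 2) ≤ 8 := le_trans (Nat.le_mul_of_pos_right _ (Nat.mul_pos hn₁ hn₂)) hk8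
  refine ⟨?_, hn₁, hn₂, hprod, fun hr => ?_⟩
  · by_contra hr
    have h16 : 2 ^ 4 ≤ 2 ^ (r + 2) := Nat.pow_le_pow_right (by norm_num) (by omega)
    omega
  · subst hr
    norm_num at hk8
    constructor <;> nlinarith

/-- **`corank_{ℤ₂} Sel_{2^∞}(E/ℚ) ≤ 1` from a complete `2`-isogeny descent with `#S · #S' ≤ 8`**, for
`E = E_{a,b} : y² = x³ + ax² + bx`. By the exact count `2^{dim S + dim S'} = 2^{rank+2}·#Ш(E')[φ̂]·#Ш(E)[φ]`
(`two_pow_twoIsogenySelmerRank_add_eq`, Silverman X.4.2(a)): `rank ≤ 1`; if `rank = 1` both `φ`-parts vanish, so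
`Ш(E)[2] = 0` (`forall_mem_sha_two_smul_eq_zero_of_halfModel`) and `corank = rank + corank Ш[2^∞] = 1`; if
`rank = 0` then `#Ш(E')[φ̂]·#Ш(E)[φ] ≤ 2`, hence `#Ш(E)[2] ≤ 2` (§1) and `corank Ш(E)[2^∞] ≤ 1` (§2), so
`corank = 0 + corank Ш[2^∞] ≤ 1` (Greenberg's corank identity `selmerCorank_eq_mordellWeilRank_add_holds`).
[cite: SilvermanAEC2009, Thm. X.4.2(a) and Prop. X.4.9] [cite: Greenberg1999, §1] -/
theorem selmerCorank_two_le_one_of_card_mul_le {a b : ℤ} (hab : b * (a ^ 2 - 4 * b) ≠ 0)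
    [hV₀ : (⟨0, -(a : ℚ) / 2, 0, ((a : ℚ) ^ 2 - 4 * b) / 16, 0⟩ : WeierstrassCurve ℚ).IsElliptic]
    [hE : (⟨0, (a : ℚ), 0, (b : ℚ), 0⟩ : WeierstrassCurve ℚ).IsElliptic]
    (hSS : (twoIsogenySelmerGroup a b).card * (twoIsogenySelmerGroup' a b).card ≤ 8) :
    (⟨0, (a : ℚ), 0, (b : ℚ), 0⟩ : WeierstrassCurve ℚ).selmerCorank 2 ≤ 1 := by
  haveI : Fact (Nat.Prime 2) := ⟨Nat.prime_two⟩
  set V₀ : WeierstrassCurve ℚ := ⟨0, -(a : ℚ) / 2, 0, ((a : ℚ) ^ 2 - 4 * b) / 16, 0⟩ with hV₀def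
  set E : WeierstrassCurve ℚ := ⟨0, (a : ℚ), 0, (b : ℚ), 0⟩ with hEdef
  have key := two_pow_twoIsogenySelmerRank_add_eq hab
  have h8 : 2 ^ (twoIsogenySelmerRank a b + twoIsogenySelmerRank' a b) ≤ 8 := by
    rw [pow_add, two_pow_twoIsogenySelmerRank_eq_card hab, two_pow_twoIsogenySelmerRank'_eq_card hab]
    exact hSS
  obtain ⟨hr, hX, hY, hXY, hone⟩ := corank_arith key h8 (by positivity)
  have hcorank := E.selmerCorank_eq_mordellWeilRank_add_holds 2
  rcases Nat.le_one_iff_eq_zero_or_eq_one.mp hr with h0 | h1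
  · -- rank `0`: `#Ш(E)[2] ≤ #Ш(V₀)[Ξ]·#Ш(E)[Ξ] ≤ 2`
    have hE' : V₀.twoIsogenyCodomain = E := twoIsogenyCodomain_halfModel a b
    haveI : Finite ↥(V₀.sha ⊓ AddMonoidHom.range (G := Additive (SqUnits ℚ)) V₀.twoIsogenyTorsorHom) :=
      Nat.finite_of_card_ne_zero hX.ne'
    haveI : Finite ↥(V₀.twoIsogenyCodomain.sha ⊓
        AddMonoidHom.range (G := Additive (SqUnits ℚ)) V₀.twoIsogenyCodomain.twoIsogenyTorsorHom) := by
      refine Nat.finite_of_card_ne_zero ?_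
      rw [natCard_sha_inf_range_twoIsogenyTorsorHom_congr hE']
      exact hY.ne'
    have hle := natCard_sha_inf_torsionBy_two_le V₀
    rw [natCard_sha_inf_range_twoIsogenyTorsorHom_congr (X := V₀.twoIsogenyCodomain) hE',
      natCard_sha_inf_torsionBy_two_congr hE'] at hle
    have h2 : Nat.card ↥(E.sha ⊓ AddSubgroup.torsionBy E.galH1 2) ≤ 2 := hle.trans hXY
    haveI : Finite ↥(E.sha ⊓ AddSubgroup.torsionBy E.galH1 2) :=
      E.finite_sha_inf_torsionBy_of_selmer (WeierstrassCurve.map_torsionH1ToH1_selmerGroup_holds E)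
        E.finite_selmerGroup_holds two_ne_zero
    have hsha : E.shaCorank 2 ≤ 1 := shaCorank_two_le_one_of_natCard_le E h2
    rw [hcorank, h0, zero_add]
    exact hsha
  · -- rank `1`: `Ш(E)[2] = 0`
    obtain ⟨h₁, h₂⟩ := hone h1
    have hforall := forall_mem_sha_two_smul_eq_zero_of_halfModel (a := a) (b := b)
      (AddSubgroup.eq_bot_of_card_eq _ h₁) (AddSubgroup.eq_bot_of_card_eq _ h₂)
    have hsha : E.shaCorank 2 = 0 := E.shaCorank_eq_zero_of_forall 2 hforall
    rw [hcorank, h1, hsha]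

end TwoTorsionModel

end Summit.BirchSwinnertonDyer.BirchSwinnertonDyer.Theorems.GoldfeldGoodTwists

end
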